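import Summits.Parity.GeneralizedHardyLittlewood.Theorems.BeyondDiagonalBeatsQuarter.OffDiagDualCostBesselSqrt
import Summits.Parity.GeneralizedHardyLittlewood.Theorems.BeyondDiagonalBeatsQuarter.OffDiagDualCostCutoff
import HarnessLib

/-!
# Route `PrimeLevelFamEdge`, crux K_B (stmt-Parity-20343), line `diagonal_kernel_split` rev 4, plan Ω,
# lemma L2c (derivative costs), step 4: **all derivatives of the layer PROFILE `G(t) = C·t^{−1/2}·W(at)·J₁(b√t)`**

The real weight of a layer of `offDiag` (d5's `OffDiag.layerWeightR`) depends on `(y₁,y₂)` only through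
`t = y₁y₂`: `g(y) = G(y₁y₂)`, `G(t) = (d₁d₂t)^{−1/2} W(d₁d₂t/q̂²) r⁻¹ J₁(4π√(αβt)/(qr))`, i.e.
`G = C·t^{−1/2} · W(at) · J₁(b√t)` with `C = (d₁d₂)^{−1/2}r⁻¹`, `a = d₁d₂/q̂²`, `b = 4π√(αβ)/(qr)`. Assembling
primitives 1–3 by the (weighted) Leibniz rule:

* `abs_pow_mul_iteratedDeriv_mul_le` — weighted Leibniz: bounds `|tⁱf^{(i)}| ≤ Aᵢ`, `|tʲg^{(j)}| ≤ Bⱼ` give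
  `|tⁿ(fg)^{(n)}| ≤ Σ binom(n,i) Aᵢ B_{n−i}`;
* `abs_pow_mul_iteratedDeriv_const_mul_rpow_neg_half_le` — `|tⁱ (C t^{−1/2})^{(i)}| ≤ i!·|C|·t^{−1/2}`;
* `abs_pow_mul_iteratedDeriv_cutoffW_besselJ_le` — `h = W(at)·J_n(b√t)`: `|tᵐ h^{(m)}| ≤ (m+1)·m!·mᵐ·(1+|b|√t)ᵐ`;
* **`abs_pow_mul_iteratedDeriv_profile_le`** —
  `|tⁿ G^{(n)}(t)| ≤ (n+1)²·n!·nⁿ·(1+|b|√t)ⁿ · |C| t^{−1/2}` for `a, t > 0`: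
  each `t`-derivative of the profile costs `≲ (1+Z)/t`, `Z = |b|√t` (BLUEPRINT §2; the `W`-scale `X = at` does
  not enter, by primitive 2).

Folklore real analysis, PROVED; theorems only. Helper; closes nothing.
«The programme SEARCHES and TYPES; no claim about Landau–Siegel zeros, Theorems 1–2 of arXiv:2211.02515 or
a repaired Margin232 until a kernel theorem says so.»
-/

noncomputable section

open Real Set Finset
open scoped Topology ContDiff Nat

namespace Summit.Parity.GeneralizedHardyLittlewood.Theorems.BeyondDiagonalBeatsQuarter.OffDiagPoissonTwisted

open Literature.Analysis.FunctionSpaces Literature.NumberTheory.LFunctions.KMV2000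

/-! ### Weighted Leibniz rule -/

/-- **Weighted Leibniz rule**: if `|tⁱ f^{(i)}(t)| ≤ Aᵢ` and `|tʲ g^{(j)}(t)| ≤ Bⱼ` for `i, j ≤ n`, then
`|tⁿ (fg)^{(n)}(t)| ≤ Σ_{i ≤ n} binom(n,i) Aᵢ B_{n−i}`. [folklore] -/
theorem abs_pow_mul_iteratedDeriv_mul_le {f g : ℝ → ℝ} {n : ℕ} {t : ℝ} (hf : ContDiffAt ℝ n f t)
    (hg : ContDiffAt ℝ n g t) {A B : ℕ → ℝ} (hA : ∀ i, i ≤ n → |t ^ i * iteratedDeriv i f t| ≤ A i)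
    (hB : ∀ j, j ≤ n → |t ^ j * iteratedDeriv j g t| ≤ B j) :
    |t ^ n * iteratedDeriv n (fun s => f s * g s) t| ≤
      ∑ i ∈ Finset.range (n + 1), (n.choose i : ℝ) * A i * B (n - i) := by
  rw [iteratedDeriv_fun_mul hf hg, Finset.mul_sum]
  refine (Finset.abs_sum_le_sum_abs _ _).trans (Finset.sum_le_sum fun i hi => ?_)
  have hi' : i ≤ n := Nat.lt_succ_iff.mp (Finset.mem_range.mp hi)
  have e : t ^ n * ((n.choose i : ℝ) * iteratedDeriv i f t * iteratedDeriv (n - i) g t) =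
      (n.choose i : ℝ) * ((t ^ i * iteratedDeriv i f t) * (t ^ (n - i) * iteratedDeriv (n - i) g t)) := by
    rw [← pow_mul_pow_sub t hi']; ring
  rw [e, abs_mul, abs_mul, Nat.abs_cast, mul_assoc]
  have hA0 : 0 ≤ A i := (abs_nonneg _).trans (hA i hi')
  exact mul_le_mul_of_nonneg_left (mul_le_mul (hA i hi') (hB _ (Nat.sub_le n i)) (abs_nonneg _) hA0)
    (Nat.cast_nonneg _)

/-! ### The power factor `C·t^{−1/2}` -/

/-- `|c(−1/2, i)| ≤ i!` for the falling factorial `c(p,i) = ∏_{m<i}(p − m)`. [folklore] -/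
theorem abs_rpowCoeff_neg_half_le (i : ℕ) : |∏ m ∈ Finset.range i, (-(1 : ℝ) / 2 - m)| ≤ i ! := by
  induction i with
  | zero => simp
  | succ i ih =>
    rw [Finset.prod_range_succ, abs_mul, Nat.factorial_succ, Nat.cast_mul, mul_comm ((i + 1 : ℕ) : ℝ)]
    refine mul_le_mul ih ?_ (abs_nonneg _) (by positivity)
    rw [abs_le]
    push_cast
    constructor <;> linarith

/-- **The power factor**: `|tⁱ · (dⁱ/dtⁱ)(C·t^{−1/2})| ≤ i!·|C|·t^{−1/2}` for `t > 0`. [folklore] -/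
theorem abs_pow_mul_iteratedDeriv_const_mul_rpow_neg_half_le (C : ℝ) (i : ℕ) {t : ℝ} (ht : 0 < t) :
    |t ^ i * iteratedDeriv i (fun s : ℝ => C * s ^ (-(1 : ℝ) / 2)) t| ≤ i ! * |C| * t ^ (-(1 : ℝ) / 2) := by
  rw [iteratedDeriv_const_mul_rpow C (-(1 : ℝ) / 2) i (mem_Ioi.mpr ht)]
  dsimp only
  have hsplit : t ^ (-(1 : ℝ) / 2 - i) = t ^ (-(1 : ℝ) / 2) * (t ^ i)⁻¹ := by
    rw [Real.rpow_sub ht, Real.rpow_natCast, div_eq_mul_inv]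
  rw [hsplit, show t ^ i * (C * (∏ m ∈ Finset.range i, (-(1 : ℝ) / 2 - m)) * (t ^ (-(1 : ℝ) / 2) * (t ^ i)⁻¹)) =
      C * (∏ m ∈ Finset.range i, (-(1 : ℝ) / 2 - m)) * t ^ (-(1 : ℝ) / 2) * (t ^ i * (t ^ i)⁻¹) by ring,
    mul_inv_cancel₀ (pow_ne_zero i ht.ne'), mul_one, abs_mul, abs_mul,
    abs_of_pos (Real.rpow_pos_of_pos ht _)]
  have h := abs_rpowCoeff_neg_half_le i
  have hC := abs_nonneg C
  have hp : 0 < t ^ (-(1 : ℝ) / 2) := Real.rpow_pos_of_pos ht _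
  nlinarith [mul_nonneg hC hp.le, mul_le_mul_of_nonneg_left h hC]

/-! ### The factor `W(at)·J_n(b√t)` -/

/-- Smoothness at `t > 0` of the two factors. [folklore] -/
theorem contDiffAt_cutoffW_comp_mul {a : ℝ} (ha : 0 < a) {t : ℝ} (ht : 0 < t) (n : ℕ) :
    ContDiffAt ℝ n (fun s : ℝ => cutoffW (a * s)) t := by
  have h := (contDiffAt_cutoffW (mul_pos ha ht)).comp t (contDiffAt_const.mul contDiffAt_id)
  exact (h.of_le (by exact_mod_cast le_top))

/-- Smoothness at `t > 0` of `s ↦ J_n(b√s)`. [folklore] -/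
theorem contDiffAt_besselJ_sqrt (m : ℕ) (b : ℝ) {t : ℝ} (ht : 0 < t) (n : ℕ) :
    ContDiffAt ℝ n (fun s : ℝ => besselJ m (b * Real.sqrt s)) t :=
  ((contDiff_besselJ_holds m).contDiffAt).comp t (contDiffAt_const.mul (contDiffAt_sqrt ht.ne'))

/-- **The factor `h(t) = W(at)·J_n(b√t)`**: `|tᵐ h^{(m)}(t)| ≤ (m+1)·m!·mᵐ·(1+|b|√t)ᵐ` for `a, t > 0`.
[folklore] -/
theorem abs_pow_mul_iteratedDeriv_cutoffW_besselJ_le {a : ℝ} (ha : 0 < a) (nB : ℕ) (b : ℝ) (m : ℕ) {t : ℝ}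
    (ht : 0 < t) :
    |t ^ m * iteratedDeriv m (fun s : ℝ => cutoffW (a * s) * besselJ nB (b * Real.sqrt s)) t| ≤
      (m + 1) * m ! * (m : ℝ) ^ m * (1 + |b| * Real.sqrt t) ^ m := by
  set Z : ℝ := 1 + |b| * Real.sqrt t with hZ
  have hZ1 : 1 ≤ Z := by rw [hZ]; linarith [mul_nonneg (abs_nonneg b) (Real.sqrt_nonneg t)]
  -- the Bessel factor: `|t^j (J∘√)^{(j)}| ≤ j! j^j Z^j`
  have hB : ∀ j, j ≤ m → |t ^ j * iteratedDeriv j (fun s : ℝ => besselJ nB (b * Real.sqrt s)) t| ≤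
      j ! * (j : ℝ) ^ j * Z ^ j := by
    intro j _
    have h := norm_iteratedDeriv_besselJ_sqrt_le nB j b ht
    rw [Real.norm_eq_abs] at h
    rw [abs_mul, abs_of_pos (pow_pos ht j)]
    calc t ^ j * |iteratedDeriv j (fun s : ℝ => besselJ nB (b * Real.sqrt s)) t|
        ≤ t ^ j * (j ! * (j * Z / t) ^ j) := mul_le_mul_of_nonneg_left h (pow_pos ht j).le
      _ = j ! * (j : ℝ) ^ j * Z ^ j * (t ^ j * (t ^ j)⁻¹) := by rw [div_pow, mul_pow]; ring
      _ = j ! * (j : ℝ) ^ j * Z ^ j := by rw [mul_inv_cancel₀ (pow_ne_zero j ht.ne'), mul_one]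
  have hmain := abs_pow_mul_iteratedDeriv_mul_le (contDiffAt_cutoffW_comp_mul ha ht m)
    (contDiffAt_besselJ_sqrt nB b ht m) (A := fun j => (j ! : ℝ)) (B := fun j => j ! * (j : ℝ) ^ j * Z ^ j)
    (fun j _ => abs_pow_mul_iteratedDeriv_cutoffW_comp_mul_le ha j ht) hB
  refine hmain.trans ?_
  -- each term `binom(m,i) i! (m-i)! (m-i)^{m-i} Z^{m-i} = m! (m-i)^{m-i} Z^{m-i} ≤ m! m^m Z^m`
  have hterm : ∀ i ∈ Finset.range (m + 1),
      (m.choose i : ℝ) * (i ! : ℝ) * ((m - i) ! * ((m - i : ℕ) : ℝ) ^ (m - i) * Z ^ (m - i)) ≤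
        m ! * (m : ℝ) ^ m * Z ^ m := by
    intro i hi
    have hi' : i ≤ m := Nat.lt_succ_iff.mp (Finset.mem_range.mp hi)
    have hfac : (m.choose i : ℝ) * (i ! : ℝ) * ((m - i) ! : ℝ) = m ! := by
      exact_mod_cast Nat.choose_mul_factorial_mul_factorial hi'
    have h1 : ((m - i : ℕ) : ℝ) ^ (m - i) ≤ (m : ℝ) ^ m := by
      rcases Nat.eq_zero_or_pos (m - i) with h0 | hpos
      · rw [h0, pow_zero]
        rcases Nat.eq_zero_or_pos m with rfl | hm
        · simp
        · exact one_le_pow₀ (by exact_mod_cast hm)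
      · calc ((m - i : ℕ) : ℝ) ^ (m - i) ≤ (m : ℝ) ^ (m - i) :=
            pow_le_pow_left₀ (Nat.cast_nonneg _) (by exact_mod_cast Nat.sub_le m i) _
          _ ≤ (m : ℝ) ^ m := pow_le_pow_right₀ (by exact_mod_cast (show 1 ≤ m by omega)) (Nat.sub_le m i)
    have h2 : Z ^ (m - i) ≤ Z ^ m := pow_le_pow_right₀ hZ1 (Nat.sub_le m i)
    calc (m.choose i : ℝ) * (i ! : ℝ) * ((m - i) ! * ((m - i : ℕ) : ℝ) ^ (m - i) * Z ^ (m - i))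
        = m ! * (((m - i : ℕ) : ℝ) ^ (m - i) * Z ^ (m - i)) := by rw [← hfac]; ring
      _ ≤ m ! * ((m : ℝ) ^ m * Z ^ m) := by
          refine mul_le_mul_of_nonneg_left ?_ (by positivity)
          exact mul_le_mul h1 h2 (by positivity) (by positivity)
      _ = m ! * (m : ℝ) ^ m * Z ^ m := by ring
  calc ∑ i ∈ Finset.range (m + 1), (m.choose i : ℝ) * (i ! : ℝ) *
        ((m - i) ! * ((m - i : ℕ) : ℝ) ^ (m - i) * Z ^ (m - i))
      ≤ ∑ _i ∈ Finset.range (m + 1), (m ! * (m : ℝ) ^ m * Z ^ m) := Finset.sum_le_sum hterm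
    _ = (m + 1) * m ! * (m : ℝ) ^ m * Z ^ m := by
        rw [Finset.sum_const, Finset.card_range, nsmul_eq_mul]; push_cast; ring


/-! ### The profile `G = C·t^{−1/2} · (W(at)·J_n(b√t))` -/

/-- **All derivatives of the layer profile.** For `G(t) = C·t^{−1/2}·W(at)·J_n(b√t)` with `a, t > 0`:
`|tⁿ G^{(n)}(t)| ≤ (n+1)²·n!·nⁿ·(1+|b|√t)ⁿ · |C|·t^{−1/2}` — `n` derivatives of the profile cost
`≲ ((1+Z)/t)ⁿ` times its size `|C|t^{−1/2}` (`Z = |b|√t`; OMEGA-BLUEPRINT §2). [folklore] -/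
theorem abs_pow_mul_iteratedDeriv_profile_le (C : ℝ) {a : ℝ} (ha : 0 < a) (nB : ℕ) (b : ℝ) (n : ℕ) {t : ℝ}
    (ht : 0 < t) :
    |t ^ n * iteratedDeriv n (fun s : ℝ =>
        C * s ^ (-(1 : ℝ) / 2) * (cutoffW (a * s) * besselJ nB (b * Real.sqrt s))) t| ≤
      ((n : ℝ) + 1) ^ 2 * n ! * (n : ℝ) ^ n * (1 + |b| * Real.sqrt t) ^ n * (|C| * t ^ (-(1 : ℝ) / 2)) := by
  set Z : ℝ := 1 + |b| * Real.sqrt t with hZ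
  have hZ1 : 1 ≤ Z := by rw [hZ]; linarith [mul_nonneg (abs_nonneg b) (Real.sqrt_nonneg t)]
  set S : ℝ := |C| * t ^ (-(1 : ℝ) / 2) with hS
  have hS0 : 0 ≤ S := mul_nonneg (abs_nonneg C) (Real.rpow_pos_of_pos ht _).le
  have hf : ContDiffAt ℝ n (fun s : ℝ => C * s ^ (-(1 : ℝ) / 2)) t :=
    contDiffAt_const.mul (contDiffAt_rpow_const_of_ne ht.ne')
  have hh : ContDiffAt ℝ n (fun s : ℝ => cutoffW (a * s) * besselJ nB (b * Real.sqrt s)) t :=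
    (contDiffAt_cutoffW_comp_mul ha ht n).mul (contDiffAt_besselJ_sqrt nB b ht n)
  have hA : ∀ i, i ≤ n → |t ^ i * iteratedDeriv i (fun s : ℝ => C * s ^ (-(1 : ℝ) / 2)) t| ≤ i ! * S := by
    intro i _
    have h := abs_pow_mul_iteratedDeriv_const_mul_rpow_neg_half_le C i ht
    rw [hS, ← mul_assoc]; exact h
  have hmain := abs_pow_mul_iteratedDeriv_mul_le hf hh (A := fun i => i ! * S)
    (B := fun m => (m + 1) * m ! * (m : ℝ) ^ m * Z ^ m) hA
    (fun m _ => abs_pow_mul_iteratedDeriv_cutoffW_besselJ_le ha nB b m ht)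
  refine hmain.trans ?_
  have hterm : ∀ i ∈ Finset.range (n + 1),
      (n.choose i : ℝ) * ((i ! : ℝ) * S) *
          ((((n - i : ℕ) : ℝ) + 1) * ((n - i) ! : ℝ) * ((n - i : ℕ) : ℝ) ^ (n - i) * Z ^ (n - i)) ≤
        ((n : ℝ) + 1) * n ! * (n : ℝ) ^ n * Z ^ n * S := by
    intro i hi
    have hi' : i ≤ n := Nat.lt_succ_iff.mp (Finset.mem_range.mp hi)
    have hfac : (n.choose i : ℝ) * (i ! : ℝ) * ((n - i) ! : ℝ) = n ! := by
      exact_mod_cast Nat.choose_mul_factorial_mul_factorial hi'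
    have h1 : ((n - i : ℕ) : ℝ) ^ (n - i) ≤ (n : ℝ) ^ n := by
      rcases Nat.eq_zero_or_pos (n - i) with h0 | hpos
      · rw [h0, pow_zero]
        rcases Nat.eq_zero_or_pos n with rfl | hn
        · simp
        · exact one_le_pow₀ (by exact_mod_cast hn)
      · calc ((n - i : ℕ) : ℝ) ^ (n - i) ≤ (n : ℝ) ^ (n - i) :=
            pow_le_pow_left₀ (Nat.cast_nonneg _) (by exact_mod_cast Nat.sub_le n i) _
          _ ≤ (n : ℝ) ^ n := pow_le_pow_right₀ (by exact_mod_cast (show 1 ≤ n by omega)) (Nat.sub_le n i)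
    have h2 : Z ^ (n - i) ≤ Z ^ n := pow_le_pow_right₀ hZ1 (Nat.sub_le n i)
    have h3 : ((n - i : ℕ) : ℝ) + 1 ≤ (n : ℝ) + 1 := by
      have : ((n - i : ℕ) : ℝ) ≤ n := by exact_mod_cast Nat.sub_le n i
      linarith
    calc (n.choose i : ℝ) * ((i ! : ℝ) * S) *
          ((((n - i : ℕ) : ℝ) + 1) * ((n - i) ! : ℝ) * ((n - i : ℕ) : ℝ) ^ (n - i) * Z ^ (n - i))
        = ((n.choose i : ℝ) * (i ! : ℝ) * ((n - i) ! : ℝ)) *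
            ((((n - i : ℕ) : ℝ) + 1) * (((n - i : ℕ) : ℝ) ^ (n - i) * Z ^ (n - i))) * S := by ring
      _ ≤ (n ! : ℝ) * (((n : ℝ) + 1) * ((n : ℝ) ^ n * Z ^ n)) * S := by
          rw [hfac]
          refine mul_le_mul_of_nonneg_right (mul_le_mul_of_nonneg_left ?_ (by positivity)) hS0
          exact mul_le_mul h3 (mul_le_mul h1 h2 (by positivity) (by positivity)) (by positivity)
            (by positivity)
      _ = ((n : ℝ) + 1) * n ! * (n : ℝ) ^ n * Z ^ n * S := by ring
  calc ∑ i ∈ Finset.range (n + 1), (n.choose i : ℝ) * ((i ! : ℝ) * S) *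
        ((((n - i : ℕ) : ℝ) + 1) * ((n - i) ! : ℝ) * ((n - i : ℕ) : ℝ) ^ (n - i) * Z ^ (n - i))
      ≤ ∑ _i ∈ Finset.range (n + 1), ((n : ℝ) + 1) * n ! * (n : ℝ) ^ n * Z ^ n * S :=
        Finset.sum_le_sum hterm
    _ = ((n : ℝ) + 1) ^ 2 * n ! * (n : ℝ) ^ n * Z ^ n * S := by
        rw [Finset.sum_const, Finset.card_range, nsmul_eq_mul]; push_cast; ring

end Summit.Parity.GeneralizedHardyLittlewood.Theorems.BeyondDiagonalBeatsQuarter.OffDiagPoissonTwisted
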